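import Mathlib
import Summits.KontsevichZagierPeriods.Zeta5Search.BrickDigitStripMain
import Summits.KontsevichZagierPeriods.Zeta5Search.BrickLambda

/-!
# BrickTwoDigitMain — THE TWO-DIGIT FACTORISATION (E1⁺), MAIN CASE:
`p^d·c_{j,A−d}(n) ≡ c_{j₀,A}(n₀)·c̃_{J,A−d}(N) (mod p)` for `n = n₀ + Np`, `j = j₀ + Jp`, `N < p` (zi-p2 THEOREM 6
Step E⁺ (b); cell zeta5-irr)

HONEST FRAMING: systematic search; no irrationality claim unless certified. INSTRUMENT lemma of the ζ(5)
census cell zeta5-irr (HOME `run/shared/lean/pub/zeta5-irr/`; memo `zi-p2/probes/B8/thm6/THEOREM6.md` Step E⁺: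
«(E1⁺) `ρ_j^{(s)} ≡ c_{j_0,A}(n_0)·cell̃^{(s)}_{j_1}(n_1) (mod p)` … (b) MAIN CASE: `j_0 ≤ n_0`, `n_0 + j_0 ≤ p−1`,
`2n_0 − j_0 ≤ p−1`, `p ∤ (n−2j)` … CONCLUSION `p^{A−s}c_{j,s}(n) ≡ λ_j·c̃_{j_1,s}(n_1) ≡ c_{j_0,A}(n_0)·c̃_{j_1,s}(n_1)
(mod p)`»). Nothing here is about ζ(5); no irrationality content; filing moves no rung. Filed by the engine seat
zi-eng (g8): assembly of `BrickDigitStripMain.laurent_rescale_eq_sum` (E2), `BrickLambda.lambda_congr`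
(`λ_j ≡ c_{j₀,A}(n₀)`), `BrickTopKummer.laurent_valuation_abs` (one-digit integrality of the level-`N` cells, `N < p`).

## The statement

`p` odd prime, `2B ≤ A`, `n = n₀ + N·p` with `N < p` (two digits), `j = j₀ + J·p`, MAIN CASE `j₀ ≤ n₀`, `n₀ + j₀ < p`,
`n₀ + (n₀ − j₀) < p`, `J ≤ N`, and `ε = 0` or `p ∤ n − 2j`. Then for every depth `d` (`laurent_two_digit`):

**`v_p(p^d·laurent A B ε n j d − cTop A B ε n₀ j₀ · laurent A B 0 N J d) ≥ 1`**,

i.e. (`cell_two_digit`, `d = A − s`) **`p^{A−s}·c_{j,s}(n) ≡ c_{j₀,A}(n₀)·c̃_{J,s}(N) (mod p)`** — THEOREM 6's (E1⁺)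
for `s ≥ 1` in the main case (`ρ_j^{(s)} = p^{τ_s+1}c_{j,s}(n)`, `τ_s + 1 = A − s`). The vanishing/carry cases
(`j₀ > n₀`, `n₀ + j₀ ≥ p`, `2n₀ − j₀ ≥ p`, `p ∣ n − 2j`) and the harmonic cell `s = 0` are NOT treated here.
-/

namespace Summit.KontsevichZagierPeriods.Zeta5Search.BrickTwoDigitMain

open Finset Nat WithZero
open Summit.KontsevichZagierPeriods.Zeta5Search.BrickTopCoefficient (cTop)
open Summit.KontsevichZagierPeriods.Zeta5Search.BrickLaurent (laurent cell laurent_zero)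
open Summit.KontsevichZagierPeriods.Zeta5Search.BrickDigitStripMain (laurent_rescale_eq_sum)
open Summit.KontsevichZagierPeriods.Zeta5Search.BrickLambda (lambda_congr)
open Summit.KontsevichZagierPeriods.Zeta5Search.BrickTopKummer (laurent_valuation_abs)
open Literature.NumberTheory.LFunctions (padicValuation_natCast_le_one)

noncomputable section

variable {p : ℕ} [Fact p.Prime]

/-- **(E1⁺), MAIN CASE, depth form.** -/
theorem laurent_two_digit (hp2 : p ≠ 2) {A B ε N n₀ J j₀ n j : ℕ} (hAB : 2 * B ≤ A) (hn : n = n₀ + N * p)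
    (hj : j = j₀ + J * p) (hN : N < p) (hj₀ : j₀ ≤ n₀) (h1 : n₀ + j₀ < p) (h2 : n₀ + (n₀ - j₀) < p) (hJN : J ≤ N)
    (hcen : ε = 0 ∨ ¬ (p : ℤ) ∣ (n : ℤ) - 2 * j) (d : ℕ) :
    Rat.padicValuation p ((p : ℚ) ^ d * laurent A B ε n j d - cTop A B ε n₀ j₀ * laurent A B 0 N J d) < 1 := by
  have hp : p.Prime := Fact.out
  have hn₀ : n₀ < p := by omega
  obtain ⟨U, hU0, hUint, lam, hsum, hlam⟩ :=
    laurent_rescale_eq_sum (p := p) hp2 (A := A) (B := B) (ε := ε) hn₀ hj₀ h1 h2 hJN hn hj hcen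
  -- `λ ≡ c_{j₀,A}(n₀)` and `λ ∈ ℤ_(p)`
  have hjn : j ≤ n := by rw [hn, hj]; nlinarith
  rw [laurent_zero hAB 0 hJN, laurent_zero hAB ε hjn, hn, hj] at hlam
  obtain ⟨hlam1, hlamc⟩ := lambda_congr (p := p) hp2 (A := A) (B := B) (ε := ε) hj₀ h1 h2 hJN hlam
  -- the level-`N` cells are `p`-integral (`N < p`, symmetric kernel)
  have hcell : ∀ e, Rat.padicValuation p (laurent A B 0 N J e) ≤ 1 := fun e => by
    have h := laurent_valuation_abs (p := p) hp2 hAB (L := 0) (ε := 0) (by simpa using hN) hJN (Or.inr rfl) e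
    rwa [Nat.cast_zero, zero_mul, exp_zero] at h
  -- split off the `g = 0` term of the two-scale sum
  rw [hsum d, Finset.Nat.sum_antidiagonal_eq_sum_range_succ (fun e g => laurent A B 0 N J e * PowerSeries.coeff g U) d,
    Finset.sum_range_succ, Nat.sub_self, PowerSeries.coeff_zero_eq_constantCoeff_apply, hU0, mul_one,
    show lam * (∑ k ∈ range d, laurent A B 0 N J k * PowerSeries.coeff (d - k) U + laurent A B 0 N J d) -
        cTop A B ε n₀ j₀ * laurent A B 0 N J d =
      lam * ∑ k ∈ range d, laurent A B 0 N J k * PowerSeries.coeff (d - k) U +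
        (lam - cTop A B ε n₀ j₀) * laurent A B 0 N J d by ring]
  refine (Valuation.map_add _ _ _).trans_lt (max_lt ?_ ?_)
  · rw [map_mul]
    refine (mul_le_mul' hlam1 le_rfl).trans_lt ?_
    rw [one_mul]
    refine Valuation.map_sum_lt _ one_ne_zero fun k hk => ?_
    have hk' := mem_range.1 hk
    rw [map_mul]
    calc Rat.padicValuation p (laurent A B 0 N J k) * Rat.padicValuation p (PowerSeries.coeff (d - k) U)
        ≤ 1 * exp ((-1 : ℤ) * (d - k : ℕ) + 0) := mul_le_mul' (hcell k) (hUint (d - k))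
      _ < 1 := by rw [one_mul, ← exp_zero, exp_lt_exp]; push_cast [hk'.le]; omega
  · rw [map_mul]
    exact (mul_le_mul' le_rfl (hcell d)).trans_lt (by rwa [mul_one])

/-- **(E1⁺), MAIN CASE, cell form**: `p^{A−s}·c_{j,s}(n) ≡ c_{j₀,A}(n₀)·c̃_{J,s}(N) (mod p)`. -/
theorem cell_two_digit (hp2 : p ≠ 2) {A B ε N n₀ J j₀ n j : ℕ} (hAB : 2 * B ≤ A) (hn : n = n₀ + N * p)
    (hj : j = j₀ + J * p) (hN : N < p) (hj₀ : j₀ ≤ n₀) (h1 : n₀ + j₀ < p) (h2 : n₀ + (n₀ - j₀) < p) (hJN : J ≤ N)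
    (hcen : ε = 0 ∨ ¬ (p : ℤ) ∣ (n : ℤ) - 2 * j) (s : ℕ) :
    Rat.padicValuation p ((p : ℚ) ^ (A - s) * cell A B ε n j s - cTop A B ε n₀ j₀ * cell A B 0 N J s) < 1 :=
  laurent_two_digit hp2 hAB hn hj hN hj₀ h1 h2 hJN hcen (A - s)

end

end Summit.KontsevichZagierPeriods.Zeta5Search.BrickTwoDigitMain
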